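import Summits.BirchSwinnertonDyer.BirchSwinnertonDyer.Theorems.ManinLocalTwoThreeCubeLawCubeCriterion
import Literature.NumberTheory.EllipticCurves.KuriharaNumber
import Mathlib.RingTheory.PowerSeries.Ideal
import Mathlib.RingTheory.PowerSeries.Binomial
import Mathlib.RingTheory.UniqueFactorizationDomain.Multiplicity
import HarnessLib

/-!
# (BI) `KummerCubeRootThreeBounded` — `3 ∣ c` makes the normalised cube root of the tangent-line Kummer series `3`-adically BOUNDED
# (route `ManinLocalTwoThree`, crux C3 `ManinPrimeToThreeAtNine` stmt-BirchSwinnertonDyer-22968; cell bsd-f2-manin, prover seat p3 gen 15 —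
# node (BI) of -an g37's UDC line for the reducible residual of C3, MEMO-an §80.12, HOME/an/g37/UDCKummerLine-an-g37.lean)

an's UDC line replaces the Kummer branch of `kato_shift_three` by three statements `ReducibleCaseAtNine ⟸ NC ∧ BI ∧ AN`; (BI) is the
support-sized one: for a globally minimal `W`, a datum `D` at a level `9 ∣ N`, a rational `3`-torsion point `(X₀, Y₀)` of the short model
`E_{W,c}` and the formal germ `z` (`log_{E_{W,c}} z = Σ aₙqⁿ/n`), **if `3 ∣ c` then the tangent-line Kummer series `Θ_T` has a formal cube
root `h ∈ ℚ⟦q⟧` with `h(0) = −1` and `3^K·h ∈ ℤ₍₃₎⟦q⟧` for some `K`.**  an's «Lean cost» note («Weierstrass preparation / integral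
closedness of `ℤ₃⟦X⟧` is not in Mathlib») is superseded: Mathlib has `UniqueFactorizationMonoid R⟦X⟧` for a PID `R`
(`Mathlib.RingTheory.PowerSeries.Ideal`) and `pow_dvd_pow_iff_dvd`, which is all the proof needs.

PROOF.  (§1, algebra) cube roots with a fixed non-zero constant term are unique in `K⟦X⟧` (`3 ≠ 0`); a rational cube root of a series
with constant term `−1` exists (binomial series `(1 + Y)^{1/3}`, `Mathlib.RingTheory.PowerSeries.Binomial`); `−1` is the only cube root
of `−1` in `ℚ₃` (`−3` is not a square: odd valuation); `‖q‖₃ ≤ 1 ⟹ 3 ∤ den q` is the tree's `not_dvd_den_of_norm_ratCast_le_one`.  (§2, adapted from the tree proof of E-an-55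
`ManinThreeKummerCube_holds`, p623988) `Θ_T` is `3`-adically BOUNDED: on the `3`-integral model `E♮ = E_{W,1} ⊗ ℤ₃` (cuspidal at `3`,
Honda type `p`: `exp_{E♮} ∈ ℤ₃⟦T⟧`) the germ is `c·z = [3]_{E♮}(exp_{E♮}(c′L)) =: D₃ ∈ ℤ₃⟦q⟧` and
`Θ_T = −x̂(D₃) − (Y₀/c³)D₃³ − α·(x̂(D₃)·D₃/c − (X₀/c³)D₃³)` with `x̂ = z²x(z) ∈ ℤ₃⟦z⟧`, so `3^{K₀}Θ_T ∈ ℤ₃⟦q⟧`.  (§3) E-an-55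
gives `Θ_T·B³ = A³` (`A, B ∈ ℤ₃⟦q⟧`, `B ≠ 0`), hence `(3^jA)³ = (3^{3j}Θ_T)·B³` in the UFD `ℤ₃⟦q⟧` (`3j ≥ K₀`), so `B ∣ 3^jA`, i.e.
`3^jA = B·g`; then `x = 3^{−j}g` is a cube root of `Θ_T` in `3^{−j}ℤ₃⟦q⟧` with `x(0)³ = −1`, so `x(0) = −1`, and by uniqueness `x` is the
image of the rational cube root `h`: every `3^j·hₙ` is a `3`-adic integer.

HONEST FRAMING.  This is the node (BI) alone (a statement about formal series under the hypothesis `3 ∣ c`, which no optimal curve is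
known to satisfy); (NC), (AN), the UDC input, C3, Manin's conjecture and BSD are NOT proved here.  No definitions, no named facts, no sorry.
[cite: Honda1970, Thm. 2 (p. 223) (type p at infinite height — through the tree's E-an-55)] [cite: Washington1997, Prop. 7.2–Thm. 7.3 and §7.1
(ℤ_p⟦T⟧: Weierstrass preparation, unique factorisation; here Mathlib's `UniqueFactorizationMonoid R⟦X⟧`)] [cite: SilvermanAEC2009, IV.5.5 (log/exp of the formal group)]
-/

set_option autoImplicit false
-- lint-debt: the directory name repeats the summit name (sibling precedent `ManinLocalTwoThreeManinThreeKummerCube.lean`)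
set_option linter.dupNamespace false

noncomputable section

open scoped Classical
open PowerSeries

namespace Summit.BirchSwinnertonDyer.BirchSwinnertonDyer.Theorems.ManinLocalTwoThree.KummerCubeRootBounded

/-! ## §1 Algebra of formal cube roots -/

/-- **Cube roots with a fixed non-zero constant term are unique** in `K⟦X⟧` when `K` is a domain with `3 ≠ 0`:
`u³ = v³`, `u(0) = v(0) ≠ 0` ⟹ `u = v` (`(u − v)(u² + uv + v²) = 0` and `u² + uv + v²` has constant term `3u(0)² ≠ 0`). [folklore] -/
theorem cubeRoot_unique {K : Type*} [CommRing K] [IsDomain K] (h3 : (3 : K) ≠ 0) {u v : K⟦X⟧} (huv : u ^ 3 = v ^ 3)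
    (h0 : constantCoeff u = constantCoeff v) (hu0 : constantCoeff u ≠ 0) : u = v := by
  have hfac : (u - v) * (u ^ 2 + u * v + v ^ 2) = 0 := by linear_combination huv
  rcases mul_eq_zero.mp hfac with h | h
  · exact sub_eq_zero.mp h
  · exfalso
    have hc := congrArg constantCoeff h
    rw [map_add, map_add, map_pow, map_mul, map_pow, ← h0, map_zero] at hc
    have : (3 : K) * constantCoeff u ^ 2 = 0 := by linear_combination hc
    rcases mul_eq_zero.mp this with h' | h'
    · exact h3 h'
    · exact hu0 (pow_eq_zero_iff two_ne_zero |>.mp h')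

/-- **A rational cube root exists for a rational series with constant term `−1`**: `h = −(1 + Y)^{1/3}` with `Y = −(Θ + 1) ∈ Xℚ⟦X⟧`
(binomial series; `(1+Y)^{1/3}` cubes to `1 + Y` by `binomialSeries_add`). [folklore] -/
theorem exists_cubeRoot_of_constantCoeff_eq_neg_one (Θ : ℚ⟦X⟧) (hΘ : constantCoeff Θ = -1) :
    ∃ h : ℚ⟦X⟧, h ^ 3 = Θ ∧ constantCoeff h = -1 := by
  set Y : ℚ⟦X⟧ := -(Θ + 1) with hY
  have hY0 : constantCoeff Y = 0 := by rw [hY, map_neg, map_add, hΘ, map_one]; ring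
  have hYs : HasSubst Y := HasSubst.of_constantCoeff_zero' hY0
  set g : ℚ⟦X⟧ := (PowerSeries.binomialSeries ℚ (1 / 3 : ℚ)).subst Y with hg
  have hcube : PowerSeries.binomialSeries ℚ (1 / 3 : ℚ) ^ 3 = 1 + X := by
    have h13 : (1 : ℚ) = 1 / 3 + 1 / 3 + 1 / 3 := by norm_num
    have h := PowerSeries.binomialSeries_nat (R := ℚ) (A := ℚ) 1
    rw [Nat.cast_one, pow_one, h13, PowerSeries.binomialSeries_add, PowerSeries.binomialSeries_add] at h
    rw [← h]; ring
  have hg3 : g ^ 3 = 1 + Y := by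
    rw [hg, ← coe_substAlgHom hYs, ← map_pow, hcube, map_add, map_one, coe_substAlgHom hYs, subst_X hYs]
  have hg0 : constantCoeff g = 1 := by
    rw [hg, Literature.RingTheory.FormalGroups.constantCoeff_subst_of_constantCoeff_eq_zero hY0, PowerSeries.binomialSeries_constantCoeff]
  refine ⟨-g, ?_, ?_⟩
  · rw [neg_pow, hg3, hY]; ring
  · rw [map_neg, hg0]

/-- **`−1` is the only cube root of `−1` in `ℚ₃`**: `t³ = −1`, `t ≠ −1` would give `(2t − 1)² = −3`, but `‖−3‖₃ = 3⁻¹` is not the square of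
a `3`-adic norm (`‖x‖₃ = 3^{−v(x)}`). [folklore] -/
theorem eq_neg_one_of_pow_three_eq_neg_one {t : ℚ_[3]} (ht : t ^ 3 = -1) : t = -1 := by
  have hfac : (t + 1) * (t ^ 2 - t + 1) = 0 := by linear_combination ht
  rcases mul_eq_zero.mp hfac with h | h
  · linear_combination h
  · exfalso
    have hsq : (2 * t - 1) ^ 2 = -3 := by linear_combination 4 * h
    have hne : (2 * t - 1 : ℚ_[3]) ≠ 0 := by
      intro h0; rw [h0] at hsq; norm_num at hsq
    have hnorm := congrArg (fun x : ℚ_[3] ↦ ‖x‖) hsq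
    simp only [norm_pow, norm_neg] at hnorm
    rw [Padic.norm_eq_zpow_neg_valuation hne, ← zpow_natCast, ← zpow_mul] at hnorm
    have h3 : ‖(3 : ℚ_[3])‖ = (3 : ℝ) ^ (-1 : ℤ) := by
      have := @Padic.norm_p 3 _
      rw [zpow_neg, zpow_one]; exact_mod_cast this
    rw [h3] at hnorm
    have hinj := zpow_right_injective₀ (by norm_num : (0 : ℝ) < 3) (by norm_num : (3 : ℝ) ≠ 1) hnorm
    omega

/-- **In the UFD `ℤ₃⟦X⟧`, `B³ ∣ A³ ⟹ B ∣ A`** (`pow_dvd_pow_iff_dvd`; `ℤ₃` is a PID, so `ℤ₃⟦X⟧` is factorial — Mathlib's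
`PowerSeries.instUniqueFactorizationMonoid…`). [cite: Washington1997, Thm. 7.3 and §7.1 (ℤ_p⟦T⟧ is a UFD)] -/
theorem dvd_of_pow_three_dvd_pow_three {A B : ℤ_[3]⟦X⟧} (h : B ^ 3 ∣ A ^ 3) : B ∣ A :=
  (UniqueFactorizationMonoid.pow_dvd_pow_iff_dvd (by norm_num : (3 : ℕ) ≠ 0)).mp h

/-- For `x ∈ ℚ₃` some `3^K·x` is a `3`-adic integer. [folklore] -/
theorem exists_norm_pow_mul_le_one (x : ℚ_[3]) : ∃ K : ℕ, ‖(3 : ℚ_[3]) ^ K * x‖ ≤ 1 := by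
  by_cases hx : x = 0
  · exact ⟨0, by simp [hx]⟩
  obtain ⟨K, hK⟩ : ∃ K : ℕ, -x.valuation ≤ (K : ℤ) := ⟨(-x.valuation).toNat, Int.self_le_toNat _⟩
  refine ⟨K, ?_⟩
  have h3 : ‖(3 : ℚ_[3])‖ = (3 : ℝ)⁻¹ := by exact_mod_cast Padic.norm_p (p := 3)
  rw [norm_mul, norm_pow, h3, Padic.norm_eq_zpow_neg_valuation hx, inv_pow, ← zpow_natCast, ← zpow_neg, Nat.cast_ofNat,
    ← zpow_add₀ (by norm_num : (3 : ℝ) ≠ 0)]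
  exact zpow_le_one_of_nonpos₀ (by norm_num) (by omega)

/-- Monotonicity in `K`: `‖3^K x‖ ≤ 1 ⟹ ‖3^{K'} x‖ ≤ 1` for `K ≤ K'`. [folklore] -/
theorem norm_pow_mul_le_one_mono {x : ℚ_[3]} {K K' : ℕ} (hKK' : K ≤ K') (h : ‖(3 : ℚ_[3]) ^ K * x‖ ≤ 1) :
    ‖(3 : ℚ_[3]) ^ K' * x‖ ≤ 1 := by
  obtain ⟨d, rfl⟩ := Nat.exists_eq_add_of_le hKK'
  rw [pow_add, mul_comm ((3 : ℚ_[3]) ^ K), mul_assoc, norm_mul]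
  have h3 : ‖(3 : ℚ_[3]) ^ d‖ ≤ 1 := by rw [norm_pow]; exact pow_le_one₀ (norm_nonneg _) (le_of_lt (by simpa using Padic.norm_p_lt_one (p := 3)))
  exact mul_le_one₀ h3 (norm_nonneg _) h

/-! ## §2 `Θ_T` is `3`-adically bounded (adapted from the tree proof of E-an-55, `ManinThreeKummerCube_holds`) -/

section Bounded

open WeierstrassCurve Literature.NumberTheory.EllipticCurves Literature.NumberTheory.EllipticCurves.ModularForms
  Literature.RingTheory.FormalGroups
open Summit.BirchSwinnertonDyer.Rank1Residual.ManinAdditive.CuspidalKummer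
  Summit.BirchSwinnertonDyer.Rank1Residual.ManinAdditive.CuspidalKummerThree
open Summit.BirchSwinnertonDyer.BirchSwinnertonDyer.Theorems.ManinLocalTwoThree

/-- **`Θ_T` is `3`-adically bounded at `9 ∣ N`**: for a globally minimal `W`, a datum `D` at a level `9 ∣ N`, the germ `z`
(`log_{E_{W,c}} z = Σ aₙqⁿ/n`) and ANY `X₀, Y₀ ∈ ℚ`, some `3^K·Θ` (`Θ = kummerCubeSeries W c X₀ Y₀ z`) lies in `ℤ₃⟦q⟧`.  On the
`3`-integral model `E♮ = E_{W,1} ⊗ ℤ₃` (additive at `3`, Honda type `p`) the scaled germ `D₃ = c·z = exp_{E♮}(c·L)` is `3`-integral and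
`Θ = −x̂(D₃) − (Y₀/c³)·D₃³ − α·(c⁻¹·x̂(D₃)·D₃ − (X₀/c³)·D₃³)` with `x̂ = z²x(z) ∈ ℤ₃⟦z⟧` — adapted from `ManinThreeKummerCube_holds` §A–§C, §G.
[cite: Honda1970, Thm. 2 (p. 223)] [cite: SilvermanAEC2009, IV.1 (x(z) ∈ ℤ[a₁,…,a₆]((z))) and IV.5.5] -/
theorem exists_isPadicInt_C_mul_kummerCubeSeries (W : WeierstrassCurve ℚ) [W.IsElliptic] [W.IsGloballyMinimal] {N : ℕ} [NeZero N]
    (D : ModularParametrizationData W N) (a : ℕ → ℤ) (ha : ∀ n, (a n : ℂ) = cuspCoeff D.f n) (h9 : 9 ∣ N)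
    (X₀ Y₀ : ℚ) (z : ℚ⟦X⟧) (hz : IsParamGerm W D.c a z) :
    ∃ K : ℕ, IsPadicInt (C ((3 : ℚ_[3]) ^ K) * (kummerCubeSeries W D.c X₀ Y₀ z).map (algebraMap ℚ ℚ_[3])) := by
  obtain ⟨hz0, hlog⟩ := hz
  have hc0 : D.c ≠ 0 := D.maninConstant_ne_zero_holds
  -- §A arithmetic at `3`; the `3`-integral model `E♮` (verbatim from `ManinThreeKummerCube_holds`)
  obtain ⟨ha3, hN3⟩ := lFunction_three_eq_zero_of_nine_dvd W D.isNewformOf h9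
  obtain ⟨hΔ3, hc₄3⟩ := three_dvd_Δ_and_c₄_of_hasAdditiveReductionAt W
    (hasAdditiveReductionAt_three_of_lFunction_three_eq_zero W ha3 hN3)
  obtain ⟨V, -, -, -, hVE, hEll, -, hexpint⟩ := exists_padicInt_shortModel_three W hΔ3 hc₄3
  haveI := hEll
  haveI hInt : (V.map PadicInt.Coe.ringHom).IsIntegral ℤ_[3] := V.isIntegral_map_coe
  have han : ∀ n, a n = W.LFunction n := fun n => by
    have h := ha n; rw [D.isNewformOf.2 n] at h; exact_mod_cast h
  have hrat : ∀ q : ℚ, algebraMap ℚ ℚ_[3] q = (q : ℚ_[3]) := fun q => by rw [eq_ratCast]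
  -- §B the germ read on `E♮ ⊗ ℚ₃`
  set ι : ℚ⟦X⟧ →+* ℚ_[3]⟦X⟧ := PowerSeries.map (algebraMap ℚ ℚ_[3]) with hι
  set z₃ : ℚ_[3]⟦X⟧ := ι z with hz₃
  set L₃ : ℚ_[3]⟦X⟧ := ι (lSeriesLog a) with hL₃
  set D₃ : ℚ_[3]⟦X⟧ := C ((D.c : ℚ) : ℚ_[3]) * z₃ with hD₃
  have hcz0 : constantCoeff (C (D.c : ℚ) * z) = 0 := by rw [map_mul, hz0, mul_zero]
  have hlog1 : (shortModel W 1).formalLog.subst (C (D.c : ℚ) * z) = C (D.c : ℚ) * lSeriesLog a := by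
    have h := formalLog_shortModel_subst W hc0 hz0
    rw [hlog] at h
    have hcc : (C (D.c : ℚ) : ℚ⟦X⟧) * C (D.c : ℚ)⁻¹ = 1 := by
      rw [← map_mul, mul_inv_cancel₀ (Int.cast_ne_zero.mpr hc0), map_one]
    calc (shortModel W 1).formalLog.subst (C (D.c : ℚ) * z)
        = C (D.c : ℚ) * C (D.c : ℚ)⁻¹ * (shortModel W 1).formalLog.subst (C (D.c : ℚ) * z) := by
          rw [hcc, one_mul]
      _ = C (D.c : ℚ) * lSeriesLog a := by rw [mul_assoc, ← h]
  have hz₃0 : constantCoeff z₃ = 0 := by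
    rw [hz₃, hι, ← coeff_zero_eq_constantCoeff, coeff_map, coeff_zero_eq_constantCoeff, hz0, map_zero]
  have hD₃0 : constantCoeff D₃ = 0 := by rw [hD₃, map_mul, hz₃0, mul_zero]
  have hL₃0 : constantCoeff L₃ = 0 := by
    rw [hL₃, hι, ← coeff_zero_eq_constantCoeff, coeff_map, lSeriesLog, coeff_mk]; simp
  have hlog2 : (V.map PadicInt.Coe.ringHom).formalLog.subst D₃ = C ((D.c : ℚ) : ℚ_[3]) * L₃ := by
    have h := congrArg ι hlog1
    rw [hι, map_subst_apply (HasSubst.of_constantCoeff_zero' hcz0), map_formalLog, ← hVE, map_mul,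
      map_C, map_mul, map_C, hrat] at h
    exact h
  -- §C `D₃ = [1](exp_{E♮}(c·L))` is `3`-integral
  have hcc' : ((D.c : ℚ) : ℚ_[3]) = (1 : ℕ) * ((D.c : ℚ) : ℚ_[3]) := by push_cast; ring
  set t : ℚ_[3]⟦X⟧ := (V.map PadicInt.Coe.ringHom).formalExp.subst (C ((D.c : ℚ) : ℚ_[3]) * L₃) with htdef
  have hDt : D₃ = ((V.map PadicInt.Coe.ringHom).formalMul 1).subst t :=
    eq_formalMul_subst_formalExp_of_formalLog_subst' (V.map PadicInt.Coe.ringHom) 1 hD₃0 hL₃0 hcc' hlog2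
  have hu0 : constantCoeff (C ((D.c : ℚ) : ℚ_[3]) * L₃) = 0 := by rw [map_mul, hL₃0, mul_zero]
  have ht0 : constantCoeff t = 0 := by
    rw [htdef, Literature.RingTheory.FormalGroups.constantCoeff_subst_of_constantCoeff_eq_zero hu0,
      constantCoeff_formalExp]
  have hL₃int : IsPadicInt L₃ := by
    rw [isPadicInt_iff_coeff]
    intro n
    rw [hL₃, hι, coeff_map, lSeriesLog, coeff_mk, hrat]
    by_cases hn0 : n = 0
    · subst hn0; simp
    by_cases h3n : 3 ∣ n
    · rw [han n, lFunction_eq_zero_of_three_dvd W ha3 hN3 hn0 h3n]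
      simp
    · push_cast
      rw [div_eq_mul_inv, norm_mul, padic_norm_inv_natCast_of_not_dvd h3n, mul_one]
      exact Padic.norm_int_le_one _
  have hcint : IsPadicInt (C ((D.c : ℚ) : ℚ_[3]) : ℚ_[3]⟦X⟧) := by
    rw [Rat.cast_intCast]
    exact IsPadicInt.powerSeries_C (Padic.norm_int_le_one _)
  have htint : IsPadicInt t := hexpint.powerSeries_subst (hcint.mul hL₃int) (HasSubst.of_constantCoeff_zero' hu0)
  have hD₃int : IsPadicInt D₃ := by
    rw [hDt]
    exact (isPadicInt_formalMul (V.map PadicInt.Coe.ringHom) 1).powerSeries_subst htint (HasSubst.of_constantCoeff_zero' ht0)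
  -- §G `Θ` read on `E♮ ⊗ ℚ₃`
  have hXc : ι ((shortModel W D.c).formalXMulSq.subst z) = (V.map PadicInt.Coe.ringHom).formalXMulSq.subst D₃ := by
    rw [formalXMulSq_shortModel_subst W hc0 hz0, hι,
      map_subst_apply (HasSubst.of_constantCoeff_zero' hcz0), map_formalXMulSq, ← hVE, map_mul, map_C, hrat]
  have hzs : HasSubst z := HasSubst.of_constantCoeff_zero' hz0
  have hYc : ι ((shortModel W D.c).formalYMulCube.subst z) = -(V.map PadicInt.Coe.ringHom).formalXMulSq.subst D₃ := by
    have hY : (shortModel W D.c).formalYMulCube = -(shortModel W D.c).formalXMulSq := rfl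
    rw [hY, ← coe_substAlgHom hzs, map_neg, coe_substAlgHom hzs, map_neg, hXc]
  set I : ℚ_[3]⟦X⟧ := (V.map PadicInt.Coe.ringHom).formalXMulSq.subst D₃ with hIdef
  have hIint : IsPadicInt I :=
    (isPadicInt_formalXMulSq (V.map PadicInt.Coe.ringHom)).powerSeries_subst hD₃int (HasSubst.of_constantCoeff_zero' hD₃0)
  have hcQ : ((D.c : ℚ) : ℚ_[3]) ≠ 0 := by exact_mod_cast hc0
  have hz₃D : z₃ = C (((D.c : ℚ) : ℚ_[3])⁻¹) * D₃ := by
    rw [hD₃, ← mul_assoc, ← map_mul, inv_mul_cancel₀ hcQ, map_one, one_mul]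
  -- the three constants and a common exponent `K`
  set κ₁ : ℚ_[3] := ((Y₀ : ℚ) : ℚ_[3]) * (((D.c : ℚ) : ℚ_[3])⁻¹) ^ 3 with hκ₁
  set κ₂ : ℚ_[3] := ((tangentSlope W D.c X₀ Y₀ : ℚ) : ℚ_[3]) * ((D.c : ℚ) : ℚ_[3])⁻¹ with hκ₂
  set κ₃ : ℚ_[3] := ((tangentSlope W D.c X₀ Y₀ : ℚ) : ℚ_[3]) * ((X₀ : ℚ) : ℚ_[3]) * (((D.c : ℚ) : ℚ_[3])⁻¹) ^ 3 with hκ₃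
  have hΘ : ι (kummerCubeSeries W D.c X₀ Y₀ z) = -I - C κ₁ * D₃ ^ 3 - (C κ₂ * (I * D₃) - C κ₃ * D₃ ^ 3) := by
    rw [kummerCubeSeries, smul_eq_C_mul, smul_eq_C_mul, smul_eq_C_mul, map_sub, map_sub, map_mul, map_mul, map_sub,
      map_mul, map_mul, map_pow, hYc, hXc, ← hz₃, hz₃D]
    simp only [hι, map_C, hrat, hκ₁, hκ₂, hκ₃, map_mul, map_pow]
    ring
  obtain ⟨K₁, hK₁⟩ := exists_norm_pow_mul_le_one κ₁
  obtain ⟨K₂, hK₂⟩ := exists_norm_pow_mul_le_one κ₂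
  obtain ⟨K₃, hK₃⟩ := exists_norm_pow_mul_le_one κ₃
  set K := K₁ + K₂ + K₃ with hKdef
  have hK₁' := norm_pow_mul_le_one_mono (show K₁ ≤ K by omega) hK₁
  have hK₂' := norm_pow_mul_le_one_mono (show K₂ ≤ K by omega) hK₂
  have hK₃' := norm_pow_mul_le_one_mono (show K₃ ≤ K by omega) hK₃
  refine ⟨K, ?_⟩
  have h3K : IsPadicInt (C ((3 : ℚ_[3]) ^ K) : ℚ_[3]⟦X⟧) := by
    apply IsPadicInt.powerSeries_C
    rw [norm_pow]; exact pow_le_one₀ (norm_nonneg _) (le_of_lt (by simpa using Padic.norm_p_lt_one (p := 3)))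
  have e : C ((3 : ℚ_[3]) ^ K) * ι (kummerCubeSeries W D.c X₀ Y₀ z) =
      -(C ((3 : ℚ_[3]) ^ K) * I) - C ((3 : ℚ_[3]) ^ K * κ₁) * D₃ ^ 3
        - (C ((3 : ℚ_[3]) ^ K * κ₂) * (I * D₃) - C ((3 : ℚ_[3]) ^ K * κ₃) * D₃ ^ 3) := by
    rw [hΘ]; simp only [map_mul]; ring
  change IsPadicInt (C ((3 : ℚ_[3]) ^ K) * ι (kummerCubeSeries W D.c X₀ Y₀ z))
  rw [e]
  exact ((h3K.mul hIint).neg.sub ((IsPadicInt.powerSeries_C hK₁').mul (hD₃int.pow 3))).sub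
    (((IsPadicInt.powerSeries_C hK₂').mul (hIint.mul hD₃int)).sub ((IsPadicInt.powerSeries_C hK₃').mul (hD₃int.pow 3)))

end Bounded

/-! ## §3 (BI): `3 ∣ c` ⟹ the normalised cube root of `Θ_T` is `3`-adically bounded -/

section Main

open WeierstrassCurve Literature.NumberTheory.EllipticCurves Literature.NumberTheory.EllipticCurves.ModularForms
  Literature.RingTheory.FormalGroups
open Summit.BirchSwinnertonDyer.Rank1Residual.ManinAdditive.CuspidalKummer
  Summit.BirchSwinnertonDyer.Rank1Residual.ManinAdditive.CuspidalKummerThree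
open Summit.BirchSwinnertonDyer.BirchSwinnertonDyer.Theorems.ManinLocalTwoThree

/-- **(BI) `KummerCubeRootThreeBounded` — an's UDC-line node, PROVED** (MEMO-an §80.12; its binder list and the body of an's
`IsThreeAdicallyBounded` verbatim).  For a globally minimal `W`, an `X₀(N)`-datum `D` with integral newform coefficients `aₙ`, `9 ∣ N`, a
rational point `(X₀, Y₀)` of order `3` of the short model `E_{W,c}` and the germ `z` (`log_{E_{W,c}} z = Σ aₙqⁿ/n`): if `3 ∣ c` then the
tangent-line Kummer series `Θ_T` has a formal cube root `h ∈ ℚ⟦q⟧` with `h(0) = −1` all of whose coefficients times a fixed `3^K` are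
`3`-integral.  Proof = module docstring (E-an-55 + `Θ_T` bounded + unique factorisation in `ℤ₃⟦q⟧` + `μ₃(ℚ₃) = 1`).  Nothing about
(NC), (AN), C3, Manin's conjecture or BSD is proved by this; no optimal curve with `3 ∣ c` is known.
[cite: Washington1997, Thm. 7.3 and §7.1 (ℤ_p⟦T⟧ is a UFD — here Mathlib)] [cite: Honda1970, Thm. 2 (p. 223) (through E-an-55)] -/
theorem kummerCubeRoot_threeAdicallyBounded (W : WeierstrassCurve ℚ) [W.IsElliptic] [W.IsGloballyMinimal] {N : ℕ} [NeZero N]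
    (D : ModularParametrizationData W N) (a : ℕ → ℤ) (ha : ∀ n, (a n : ℂ) = cuspCoeff D.f n) (h9 : 9 ∣ N)
    (X₀ Y₀ : ℚ) (hT : IsShortThreeTorsion W D.c X₀ Y₀) (z : ℚ⟦X⟧) (hz : IsParamGerm W D.c a z) (h3c : (3 : ℤ) ∣ D.c) :
    ∃ h : ℚ⟦X⟧, h ^ 3 = kummerCubeSeries W D.c X₀ Y₀ z ∧ constantCoeff h = -1 ∧
      ∃ K : ℕ, ∀ n : ℕ, ¬ (3 ∣ ((3 : ℚ) ^ K * coeff n h).den) := by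
  set Θ : ℚ⟦X⟧ := kummerCubeSeries W D.c X₀ Y₀ z with hΘdef
  have hΘ0 : constantCoeff Θ = -1 := constantCoeff_kummerCubeSeries W D.c X₀ Y₀ hz.1
  obtain ⟨h, hh3, hh0⟩ := exists_cubeRoot_of_constantCoeff_eq_neg_one Θ hΘ0
  refine ⟨h, hh3, hh0, ?_⟩
  -- E-an-55: `Θ·B³ = A³` over `ℤ₃⟦q⟧`
  obtain ⟨A, B, hB0, hAB⟩ := ManinThreeKummerCube_holds W D a ha h9 X₀ Y₀ hT z hz h3c
  rw [Subsingleton.elim (Rat.castHom ℚ_[3]) (algebraMap ℚ ℚ_[3])] at hAB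
  -- `Θ` is `3`-adically bounded
  obtain ⟨K, hK⟩ := exists_isPadicInt_C_mul_kummerCubeSeries W D a ha h9 X₀ Y₀ z hz
  set ι : ℚ⟦X⟧ →+* ℚ_[3]⟦X⟧ := PowerSeries.map (algebraMap ℚ ℚ_[3]) with hι
  set κ : ℤ_[3]⟦X⟧ →+* ℚ_[3]⟦X⟧ := PowerSeries.map (PadicInt.Coe.ringHom (p := 3)) with hκ
  have hκinj : Function.Injective κ := PowerSeries.map_injective _ Subtype.val_injective
  have hκint : ∀ G : ℤ_[3]⟦X⟧, IsPadicInt (κ G) := fun G ↦ isPadicInt_iff_exists_powerSeries_map.mpr ⟨G, rfl⟩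
  change ι Θ * κ B ^ 3 = κ A ^ 3 at hAB
  change IsPadicInt (C ((3 : ℚ_[3]) ^ K) * ι Θ) at hK
  -- `G ∈ ℤ₃⟦q⟧` with `G = 3^{3K}·Θ`
  have h3pow : ∀ m : ℕ, IsPadicInt (C ((3 : ℚ_[3]) ^ m) : ℚ_[3]⟦X⟧) := fun m ↦ by
    apply IsPadicInt.powerSeries_C
    rw [norm_pow]; exact pow_le_one₀ (norm_nonneg _) (le_of_lt (by simpa using Padic.norm_p_lt_one (p := 3)))
  have hK3 : IsPadicInt (C ((3 : ℚ_[3]) ^ (3 * K)) * ι Θ) := by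
    have e : C ((3 : ℚ_[3]) ^ (3 * K)) * ι Θ = C ((3 : ℚ_[3]) ^ (2 * K)) * (C ((3 : ℚ_[3]) ^ K) * ι Θ) := by
      rw [← mul_assoc, ← map_mul, ← pow_add]; congr 3; ring
    rw [e]; exact (h3pow (2 * K)).mul hK
  obtain ⟨G, hG⟩ := isPadicInt_iff_exists_powerSeries_map.mp hK3
  -- in the UFD `ℤ₃⟦q⟧`: `(3^K A)³ = G·B³`, so `B ∣ 3^K A`
  have h3κ : κ (C ((3 : ℤ_[3]) ^ K)) = C ((3 : ℚ_[3]) ^ K) := by rw [hκ, map_C, map_pow, map_ofNat]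
  have hR : (C ((3 : ℤ_[3]) ^ K) * A) ^ 3 = G * B ^ 3 := by
    apply hκinj
    have hG' : κ G = C ((3 : ℚ_[3]) ^ (3 * K)) * ι Θ := hG
    rw [map_pow, map_mul, h3κ, map_mul, hG', map_pow κ B 3, mul_pow, ← hAB, ← map_pow, ← pow_mul']
    ring
  obtain ⟨g, hg⟩ : B ∣ C ((3 : ℤ_[3]) ^ K) * A := dvd_of_pow_three_dvd_pow_three ⟨G, by rw [hR, mul_comm]⟩
  -- `x = 3^{-K}·g` is a cube root of `Θ` over `ℚ₃` with `x(0) = −1`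
  have hB₃0 : κ B ≠ 0 := fun h0 ↦ hB0 (hκinj (by rw [h0, map_zero]))
  have h3K0 : ((3 : ℚ_[3]) ^ K) ≠ 0 := pow_ne_zero K (by norm_num)
  set x : ℚ_[3]⟦X⟧ := C (((3 : ℚ_[3]) ^ K)⁻¹) * κ g with hxdef
  have hBx : κ B * x = κ A := by
    have h1 : C ((3 : ℚ_[3]) ^ K) * κ A = κ B * κ g := by rw [← h3κ, ← map_mul, hg, map_mul]
    have h2 : κ A = C (((3 : ℚ_[3]) ^ K)⁻¹) * (C ((3 : ℚ_[3]) ^ K) * κ A) := by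
      rw [← mul_assoc, ← map_mul, inv_mul_cancel₀ h3K0, map_one, one_mul]
    rw [h2, h1, hxdef]; ring
  have hx3 : x ^ 3 = ι Θ := by
    have e : κ B ^ 3 * x ^ 3 = κ B ^ 3 * ι Θ := by rw [← mul_pow, hBx, ← hAB, mul_comm]
    exact mul_left_cancel₀ (pow_ne_zero 3 hB₃0) e
  have hιΘ0 : constantCoeff (ι Θ) = -1 := by
    rw [hι, ← coeff_zero_eq_constantCoeff, coeff_map, coeff_zero_eq_constantCoeff, hΘ0, map_neg, map_one]
  have hx0 : constantCoeff x = -1 := by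
    apply eq_neg_one_of_pow_three_eq_neg_one
    rw [← map_pow, hx3, hιΘ0]
  have hιh3 : (ι h) ^ 3 = ι Θ := by rw [← map_pow, hh3]
  have hιh0 : constantCoeff (ι h) = -1 := by
    rw [hι, ← coeff_zero_eq_constantCoeff, coeff_map, coeff_zero_eq_constantCoeff, hh0, map_neg, map_one]
  have hxh : ι h = x :=
    cubeRoot_unique (by norm_num) (hιh3.trans hx3.symm) (by rw [hιh0, hx0]) (by rw [hιh0]; norm_num)
  -- hence `3^K·h ∈ ℤ₃⟦q⟧`
  have hint : IsPadicInt (C ((3 : ℚ_[3]) ^ K) * ι h) := by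
    rw [hxh, hxdef, ← mul_assoc, ← map_mul, mul_inv_cancel₀ h3K0, map_one, one_mul]
    exact hκint g
  refine ⟨K, fun n ↦ not_dvd_den_of_norm_ratCast_le_one ?_⟩
  have hn := (isPadicInt_iff_coeff.mp hint) n
  rw [coeff_C_mul, hι, coeff_map, eq_ratCast] at hn
  push_cast
  exact hn

end Main

end Summit.BirchSwinnertonDyer.BirchSwinnertonDyer.Theorems.ManinLocalTwoThree.KummerCubeRootBounded

end
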